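import Literature.Geometry.Lorentzian.LeviCivitaProofs
import HarnessLib

/-!
# A real-analytic metric has a real-analytic Levi-Civita connection

Topic `Geometry/Lorentzian` (the home of `PseudoRiemannianMetric` and of its Levi-Civita API);
support file of the programme towards the named fact
`Literature.Geometry.Riemannian.buchner1977_cutLocus_triangulable` (`Riemannian/CutLocus.lean`;
M. A. Buchner, *Simplicial structure of the real analytic cut locus*, Proc. AMS 64 (1977) 118–121),
whose first analytic input is "since `M` is analytic the geodesics are analytic" (p. 119): the
geodesic equation of a real-analytic metric has real-analytic coefficients, i.e. the Christoffel
symbols `Γ^i_{jk} = ½ g^{il}(∂_j g_{kl} + ∂_k g_{lj} - ∂_l g_{jk})` of a `C^ω` metric are `C^ω`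
(Gallot–Hulin–Lafontaine 2004, Prop. 2.54, read with `ω` in place of `∞`).

The tree proves the `C^k` statement for every `k : ℕ∞` with `k + 1 ≤ n`
(`PseudoRiemannianMetric.contMDiffAt_inCoordinates_leviCivita`, `LeviCivitaProofs.lean`, whence the
named fact `isLocallyContMDiff_leviCivita`, indexed by `k : ℕ∞` because Mathlib's class
`ContMDiffCovariantDerivativeOn` is). The exponent `ω` is not of that form, but the printed argument
is exponent-agnostic, and so is the tree's proof: this file re-runs it VERBATIM at `k = ω` for a
`C^ω` metric on a `C^ω` manifold — the frame-wise Koszul formula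
`2 g(∇_{X_v} σ, X_w) = K(X_v, σ, X_w)` on the frame `X_v : x ↦ e.symmL x v` of the trivialization
`e` of `TM` at `x₀`, the analyticity of `K` on analytic fields (derivative terms by Mathlib's
`ContMDiffAt.mfderiv_const`, bracket terms by Mathlib's
`ContMDiffWithinAt.mlieBracketWithin_vectorField`, which is stated for all exponents in `ℕ∞ω`),
and the analyticity of the inverse Gram operator `x ↦ G_x⁻¹`
(`ContinuousLinearMap.IsInvertible.contDiffAt_map_inverse`). Deviations from the tree's `C^k`
proof: none besides the exponent bookkeeping (`ω + 1 = ω`).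

* `contMDiffAt_mlieBracket_vectorField_omega` — Mathlib's `ContMDiffAt.mlieBracket_vectorField`
  at exponent `ω` (Mathlib states the `At` wrapper for exponents in `ℕ∞` only);
* `contMDiffAt_koszulFunctional_omega` — the Koszul functional of `C^ω` fields is `C^ω`;
* `contMDiffAt_inCoordinates_leviCivita_omega` — `x ↦ e_x ∘ (∇σ)_x ∘ e_x⁻¹` is `C^ω` at `x₀` for
  `σ` analytic near `x₀`;
* `contMDiffOn_hom_leviCivita_omega` — `∇σ` is a `C^ω` section of `Hom(TM, TM)` on `u` for `σ`
  analytic on the open set `u` (the sheaf form, Mathlib's `contMDiffAt_hom_bundle`);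
* `isLocallyContMDiff_leviCivita_omega`, `contMDiffCovariantDerivative_leviCivita_omega` — the
  same packaged as the tree's `CovariantDerivative.IsLocallyContMDiff ω` and as Mathlib's class
  `ContMDiffCovariantDerivative _ ω` (both indexed by `ℕ∞ω`, so `ω` is expressible there); the `C¹`
  instance used by the geodesic API is the tree's `contMDiffCovariantDerivative_leviCivita_one`
  (`FlatDevelopment.lean`).

No definitions, no named facts (D-0026).

## References

* S. Gallot, D. Hulin, J. Lafontaine, *Riemannian Geometry*, 3rd ed. (2004), Prop. 2.54 (p. 70)
  and formula (2.52). [GallotHulinLafontaine2004]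
* M. A. Buchner, Proc. AMS 64 (1977), p. 119. [Buchner1977Simplicial]
-/

noncomputable section

open Bundle Set NormedSpace FiberBundle VectorField
open scoped Manifold ContDiff Topology

namespace Literature.Geometry.Lorentzian

variable {E : Type*} [NormedAddCommGroup E] [NormedSpace ℝ E] {H : Type*} [TopologicalSpace H]
  {I : ModelWithCorners ℝ E H} {M : Type*} [TopologicalSpace M] [ChartedSpace H M]

/-- **The Lie bracket of `C^ω` vector fields is `C^ω`** (Mathlib's
`ContMDiffAt.mlieBracket_vectorField`, whose statement restricts the exponents to `ℕ∞`,
re-derived at `ω` from the unrestricted `ContMDiffWithinAt.mlieBracketWithin_vectorField`).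
[folklore] -/
theorem contMDiffAt_mlieBracket_vectorField_omega [CompleteSpace E] [IsManifold I ω M]
    {U V : Π x : M, TangentSpace I x} {x : M}
    (hU : CMDiffAt ω (T% U) x) (hV : CMDiffAt ω (T% V) x) :
    CMDiffAt ω (T% (mlieBracket I U V)) x := by
  simp only [← contMDiffWithinAt_univ, ← mlieBracketWithin_univ] at hU hV ⊢
  exact hU.mlieBracketWithin_vectorField hV uniqueMDiffOn_univ (mem_univ _)
    (by rw [minSmoothness_of_isRCLikeNormedField]; simp)

namespace PseudoRiemannianMetric

variable [IsManifold I ω M] (g : PseudoRiemannianMetric I ω E (TangentSpace I : M → Type _))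

/-- **The right-hand side of the Koszul formula is `C^ω` on `C^ω` fields** for a `C^ω` metric:
`K(A,B,C) = A g(B,C) + B g(C,A) - C g(A,B) - g(A,[B,C]) + g(B,[C,A]) + g(C,[A,B])`, the three
derivative terms by `contMDiffAt_mvfderiv_apply_of_le` (at exponent `ω`, `ω + 1 = ω`), the three
bracket terms by `contMDiffAt_mlieBracket_vectorField_omega`. The `C^k` version, `k : ℕ∞`, is the
tree's `contMDiffAt_koszulFunctional`; this is the same count at `ω` (Gallot–Hulin–Lafontaine 2004,
Prop. 2.54, analytic case). [cite: GallotHulinLafontaine2004, Prop. 2.54 (proof, p. 70)] -/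
theorem contMDiffAt_koszulFunctional_omega [CompleteSpace E] {x : M} {A B C : Π x : M, TangentSpace I x}
    (hA : CMDiffAt ω (T% A) x) (hB : CMDiffAt ω (T% B) x) (hC : CMDiffAt ω (T% C) x) :
    CMDiffAt ω (g.koszulFunctional A B C) x := by
  have htop : (ω : ℕ∞ω) + 1 = ω := by simp
  -- derivative terms `R g(P, Q)`
  have hd : ∀ {P Q R : Π x : M, TangentSpace I x}, CMDiffAt ω (T% P) x →
      CMDiffAt ω (T% Q) x → CMDiffAt ω (T% R) x →
      CMDiffAt ω (fun y ↦ mvfderiv I (fun z ↦ g.val z (P z) (Q z)) y (R y)) x := by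
    intro P Q R hP hQ hR
    have hf : CMDiffAt ((ω : ℕ∞ω) + 1) (fun z ↦ g.val z (P z) (Q z)) x := by
      rw [htop]
      exact g.contMDiffAt_val_apply le_rfl hP hQ
    exact contMDiffAt_mvfderiv_apply_of_le hf hR
  -- bracket terms `g(P, [Q, R])`
  have hb : ∀ {P Q R : Π x : M, TangentSpace I x}, CMDiffAt ω (T% P) x →
      CMDiffAt ω (T% Q) x → CMDiffAt ω (T% R) x →
      CMDiffAt ω (fun y ↦ g.val y (P y) (mlieBracket I Q R y)) x := by
    intro P Q R hP hQ hR
    have hbr : CMDiffAt ω (T% (mlieBracket I Q R)) x :=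
      contMDiffAt_mlieBracket_vectorField_omega (I := I) hQ hR
    exact g.contMDiffAt_val_apply le_rfl hP hbr
  have : g.koszulFunctional A B C = fun y ↦
      mvfderiv I (fun z ↦ g.val z (B z) (C z)) y (A y)
        + mvfderiv I (fun z ↦ g.val z (C z) (A z)) y (B y)
        - mvfderiv I (fun z ↦ g.val z (A z) (B z)) y (C y)
        - g.val y (A y) (mlieBracket I B C y) + g.val y (B y) (mlieBracket I C A y)
        + g.val y (C y) (mlieBracket I A B y) := by
    funext y; rfl
  rw [this]
  exact ((((hd hB hC hA).add (hd hC hA hB)).sub (hd hA hB hC)).sub (hb hA hB hC)).add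
    (hb hB hC hA) |>.add (hb hC hA hB)

variable [FiniteDimensional ℝ E] [CompleteSpace E] [g.HasLeviCivita]

/-- **The Levi-Civita connection of a `C^ω` metric read in a trivialization is `C^ω` on `C^ω`
fields.** For `σ` a vector field analytic on an open set `u ∋ x₀` and `e` the trivialization of
`TM` at `x₀`, `x ↦ e_x ∘ (∇σ)_x ∘ e_x⁻¹ : E →L[ℝ] E` (`ContinuousLinearMap.inCoordinates`) is
`C^ω` at `x₀`. Proof: that of the tree's `contMDiffAt_inCoordinates_leviCivita` (the argument of
Gallot–Hulin–Lafontaine 2004, Prop. 2.54, on the frame `X_v : x ↦ e.symmL x v`) at exponent `ω`: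
`G_x (c_v x) = (w ↦ ½ K(X_v, σ, X_w)(x))` on `u ∩ e.baseSet` by the Koszul formula
(`two_mul_val_leviCivita_apply_holds`), with `G_x v w = g_x(X_v x, X_w x)` the Gram operator,
analytic and invertible, so `c_v = G⁻¹(G c_v)` is analytic at `x₀`.
[cite: GallotHulinLafontaine2004, Prop. 2.54 (p. 70)] -/
theorem contMDiffAt_inCoordinates_leviCivita_omega {u : Set M} (hu : IsOpen u) {x₀ : M}
    (hx₀ : x₀ ∈ u) {σ : Π x : M, TangentSpace I x} (hσ : CMDiff[u] ω (T% σ)) :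
    CMDiffAt ω (fun x ↦ ContinuousLinearMap.inCoordinates E (TangentSpace I : M → Type _) E
      (TangentSpace I : M → Type _) x₀ x x₀ x (g.leviCivita σ x)) x₀ := by
  have hk1 : (ω : ℕ∞ω) ≠ 0 := by simp
  -- Step 0: the trivialization of `TM` at `x₀` and the open set `a = u ∩ e.baseSet`
  set e := trivializationAt E (TangentSpace I : M → Type _) x₀ with he
  have hx₀e : x₀ ∈ e.baseSet := mem_baseSet_trivializationAt E (TangentSpace I : M → Type _) x₀
  set a : Set M := u ∩ e.baseSet with ha_def
  have ha : IsOpen a := hu.inter e.open_baseSet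
  have hx₀a : x₀ ∈ a := ⟨hx₀, hx₀e⟩
  have ha_nhds : a ∈ 𝓝 x₀ := ha.mem_nhds hx₀a
  -- the frame `X v : x ↦ e.symmL x v`, analytic on `e.baseSet`
  set X : E → Π x : M, TangentSpace I x := fun v x ↦ e.symmL ℝ x v with hX_def
  have hX : ∀ v, CMDiff[e.baseSet] ω (T% (X v)) := by
    intro v
    rw [e.contMDiffOn_section_baseSet_iff]
    apply (contMDiffOn_const (c := v)).congr
    intro y hy
    simp [hX_def, hy]
  have hXk : ∀ v, ∀ x ∈ e.baseSet, CMDiffAt ω (T% (X v)) x :=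
    fun v x hx ↦ (hX v x hx).contMDiffAt (e.open_baseSet.mem_nhds hx)
  have hXd : ∀ v, ∀ x ∈ e.baseSet, MDiffAt (T% (X v)) x :=
    fun v x hx ↦ (hXk v x hx).mdifferentiableAt hk1
  -- the section `σ`
  have hσat : ∀ x ∈ u, CMDiffAt ω (T% σ) x :=
    fun x hx ↦ (hσ x hx).contMDiffAt (hu.mem_nhds hx)
  have hσd : ∀ x ∈ u, MDiffAt (T% σ) x := fun x hx ↦ (hσat x hx).mdifferentiableAt hk1
  -- Step 2: the Koszul formula on `a`
  have koszul : ∀ x ∈ a, ∀ v w : E,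
      2 * g.val x (g.leviCivita σ x (X v x)) (X w x) = g.koszulFunctional (X v) σ (X w) x :=
    fun x hx v w ↦ two_mul_val_leviCivita_apply_holds (hXd v x hx.2) (hσd x hx.1) (hXd w x hx.2)
  -- Step 3: the Gram operator `G x v w = g_x(X v x, X w x)`: `C^ω` at `x₀`, invertible on `a`
  set G : M → E →L[ℝ] E →L[ℝ] ℝ := fun x ↦
    ContinuousLinearMap.bilinearComp (show E →L[ℝ] E →L[ℝ] ℝ from g.val x)
      (show E →L[ℝ] E from e.symmL ℝ x) (show E →L[ℝ] E from e.symmL ℝ x) with hG_def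
  have hGapply : ∀ x v w, G x v w = g.val x (X v x) (X w x) := fun x v w ↦ rfl
  have hG : CMDiffAt ω G x₀ := by
    rw [contMDiffAt_clm_apply_iff]
    intro v
    rw [contMDiffAt_clm_apply_iff]
    intro w
    simp only [hGapply]
    exact g.contMDiffAt_val_apply le_rfl (hXk v x₀ hx₀e) (hXk w x₀ hx₀e)
  have hGinv : ∀ x ∈ e.baseSet, (G x).IsInvertible :=
    fun x hx ↦ g.isInvertible_bilinearComp_symmL hx
  have hGi : CMDiffAt ω (fun x ↦ (G x).inverse) x₀ :=
    (hGinv x₀ hx₀e).contDiffAt_map_inverse.comp_contMDiffAt hG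
  -- Step 5: reduce to the coordinate vectors `c x = e_x (∇_{X v} σ (x))`, one `v` at a time
  rw [contMDiffAt_clm_apply_iff]
  intro v
  set c : M → E := fun x ↦ e.continuousLinearMapAt ℝ x (g.leviCivita σ x (X v x)) with hc_def
  have hcoord : (fun x ↦ ContinuousLinearMap.inCoordinates E (TangentSpace I : M → Type _) E
      (TangentSpace I : M → Type _) x₀ x x₀ x (g.leviCivita σ x) v) = c := by
    funext x
    rfl
  rw [hcoord]
  -- Step 4: `φ x = G x (c x)` has `φ x w = ½ K(X v, σ, X w)(x)` on `a`, hence is `C^ω` at `x₀`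
  set φ : M → E →L[ℝ] ℝ := fun x ↦ G x (c x) with hφ_def
  have hφapply : ∀ x ∈ a, ∀ w, φ x w = (1 / 2 : ℝ) * g.koszulFunctional (X v) σ (X w) x := by
    intro x hx w
    have h1 : φ x w = g.val x (X (c x) x) (X w x) := hGapply x (c x) w
    have h2 : X (c x) x = g.leviCivita σ x (X v x) := e.symmL_continuousLinearMapAt hx.2 _
    rw [h1, h2, ← koszul x hx v w]
    ring
  have hφ : CMDiffAt ω φ x₀ := by
    rw [contMDiffAt_clm_apply_iff]
    intro w
    have heq : (fun x ↦ φ x w) =ᶠ[𝓝 x₀]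
        fun x ↦ (1 / 2 : ℝ) * g.koszulFunctional (X v) σ (X w) x :=
      Filter.eventually_of_mem ha_nhds fun x hx ↦ hφapply x hx w
    refine ContMDiffAt.congr_of_eventuallyEq ?_ heq
    exact ((contDiff_const (c := (1 / 2 : ℝ))).mul contDiff_id).comp_contMDiffAt
      (g.contMDiffAt_koszulFunctional_omega (hXk v x₀ hx₀e) (hσat x₀ hx₀) (hXk w x₀ hx₀e))
  -- `c = G⁻¹ φ` near `x₀`
  have hc : c =ᶠ[𝓝 x₀] fun x ↦ (G x).inverse (φ x) :=
    Filter.eventually_of_mem ha_nhds fun x hx ↦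
      ((hGinv x hx.2).inverse_apply_self (c x)).symm
  exact (hGi.clm_apply hφ).congr_of_eventuallyEq hc

/-- **A `C^ω` metric has a `C^ω` Levi-Civita connection** (sheaf form): for a vector field `σ`
analytic on an open set `u`, `x ↦ (∇σ)_x` is a `C^ω` section of `Hom(TM, TM)` on `u` — by
Mathlib's `contMDiffAt_hom_bundle` at each `x₀ ∈ u` this is
`contMDiffAt_inCoordinates_leviCivita_omega`. The `C^k` version, `k : ℕ∞`, is the tree's named fact
`isLocallyContMDiff_leviCivita` (`isLocallyContMDiff_leviCivita_holds`). In print: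
Gallot–Hulin–Lafontaine 2004, Prop. 2.54 — `Γ^i_{jk} = ½ g^{il}(∂_j g_{kl} + ∂_k g_{lj} - ∂_l g_{jk})`
is analytic in the analytic coefficients `g_{ij}`; this is Buchner's "since `M` is analytic the
geodesics are analytic" (1977, p. 119) at the level of the geodesic equation.
[cite: GallotHulinLafontaine2004, Prop. 2.54 (p. 70)] -/
theorem contMDiffOn_hom_leviCivita_omega {u : Set M} (hu : IsOpen u)
    {σ : Π x : M, TangentSpace I x} (hσ : CMDiff[u] ω (T% σ)) :
    CMDiff[u] ω (fun x ↦ (⟨x, g.leviCivita σ x⟩ :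
      TotalSpace (E →L[ℝ] E) (fun x : M ↦ TangentSpace I x →L[ℝ] TangentSpace I x))) := by
  intro x₀ hx₀
  apply ContMDiffAt.contMDiffWithinAt
  rw [contMDiffAt_hom_bundle]
  exact ⟨contMDiffAt_id, g.contMDiffAt_inCoordinates_leviCivita_omega hu hx₀ hσ⟩

/-- **A `C^ω` metric has a locally `C^ω` Levi-Civita connection** in the sense of the tree's
`CovariantDerivative.IsLocallyContMDiff` (Mathlib's `ContMDiffCovariantDerivativeOn E ω` on every
open set): the exponent `ω` case excluded from the named fact `isLocallyContMDiff_leviCivita`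
(which is stated on `C^∞` manifolds), valid on a `C^ω` manifold.
[cite: GallotHulinLafontaine2004, Prop. 2.54 (p. 70)] -/
theorem isLocallyContMDiff_leviCivita_omega : g.leviCivita.IsLocallyContMDiff ω := by
  intro u hu
  refine ⟨fun {σ} hσ x₀ hx₀ ↦ ?_⟩
  apply ContMDiffAt.contMDiffWithinAt
  rw [contMDiffAt_hom_bundle]
  exact ⟨contMDiffAt_id, g.contMDiffAt_inCoordinates_leviCivita_omega hu hx₀ (hσ.of_le le_top)⟩

/-- **The Levi-Civita connection of a `C^ω` metric is a `C^ω` covariant derivative** (Mathlib's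
class `ContMDiffCovariantDerivative _ ω`, the case `u = univ` of
`isLocallyContMDiff_leviCivita_omega`); usage: `haveI := g.contMDiffCovariantDerivative_leviCivita_omega`.
[cite: GallotHulinLafontaine2004, Prop. 2.54 (p. 70)] -/
theorem contMDiffCovariantDerivative_leviCivita_omega :
    CovariantDerivative.ContMDiffCovariantDerivative g.leviCivita ω :=
  ⟨g.isLocallyContMDiff_leviCivita_omega univ isOpen_univ⟩

end PseudoRiemannianMetric

end Literature.Geometry.Lorentzian

end
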